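import Literature.Computability.FineGrained.IPRenameRoutines
import HarnessLib

/-!
# Register routines for structured stack programs, II: entry loops, while loops, tallies,
unary comparison

Family `fine-grained` (trunk T-CPLX-FINE). Generic combinators over an arbitrary alphabet `Γ`
and register file `ι` for the structured stack programs `Literature.Computability.Complexity.ACom` of
`SymbolPrograms.lean`, continuing `IPRenameRoutines.lean`; they carry the nested scans of the
last phase of the renaming machine of Impagliazzo–Paturi's Lemma 2 (`IPRenameMachine*.lean`),
where every evaluation is a loop over the entries of a word (records of a table, literals of a
clause, entries of a variable list, digits of a counter) running a sub-program per entry.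

* `forEach src c₁ c₂ t d₁ d₂ A` consumes the register `src`, whose content is a sequence of
  entries each closed by the terminator `t`; the symbols of the current entry selected by `d₁`
  (resp. by `d₂` but not `d₁`, `sel₂`) are collected, reversed, in `c₁` (resp. `c₂`), the
  others are dropped, and at each terminator the *action* `A` (any program) is run.
  `segRuns_forEach` / `runs_forEach`, for entries `f x` indexed by a list `xs` of any type: if
  the store after the processed prefix `pre` of `xs` is described by `S pre` (outside `src`,
  `c₁`, `c₂`) and the action leads from the collected entry of `x` to `S (pre ++ [x])` with
  empty collectors, the loop computes `S xs` — a fold over the entries, whatever the action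
  (lookups, comparisons, nested loops).
* `whileLoop go body`: repeat `body` as long as it re-arms the one-symbol register `go`
  (`runs_whileLoop`: by an indexed family of stores `S i`, `i ≤ N`, the body leading from
  `S i` to `S (i+1)` and re-arming iff `i + 1 < N`).
* `tally src tk f`: consume `src`, pushing one tick onto the register `f a` for every symbol
  `a` in the domain of `f` (`runs_tally`: the counts of each class, in unary).
* `cmpU a b gt lt tk`: compare the lengths of two unary registers, consuming both
  (`runs_cmpU`: flags `|a| > |b|` and `|a| < |b|`).
* `copyToG a b t₁ t₂`: the non-destructive copy of `IPRenameMachine1.copyTo` on any register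
  file (`runs_copyToG`).

## References

* T. Nipkow, G. Klein, *Concrete Semantics with Isabelle/HOL*, Springer 2014, Ch. 7 (big-step
  semantics, loop unfolding).
* M. Minsky, *Computation: Finite and Infinite Machines*, Prentice-Hall 1967, §11.1.
-/

namespace Literature.Computability.FineGrained.IPRenameM

open Complexity Complexity.ACom

variable {Γ ι : Type} [DecidableEq Γ] [DecidableEq ι]

/-! ### Update chains over three distinct registers -/

section Upd3

variable {src c₁ c₂ : ι}

omit [DecidableEq Γ] in
/-- Overwriting the first of three stacked updates. [folklore] -/
theorem update3_first (h12 : src ≠ c₁) (h13 : src ≠ c₂) (B : AStore Γ ι) (s x y s' : List Γ) :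
    Function.update (Function.update (Function.update (Function.update B src s) c₁ x) c₂ y) src s' =
      Function.update (Function.update (Function.update B src s') c₁ x) c₂ y := by
  rw [Function.update_comm (Ne.symm h13), Function.update_comm (Ne.symm h12), Function.update_idem]

omit [DecidableEq Γ] in
/-- Overwriting the second of three stacked updates. [folklore] -/
theorem update3_second (h23 : c₁ ≠ c₂) (B : AStore Γ ι) (s x y x' : List Γ) :
    Function.update (Function.update (Function.update (Function.update B src s) c₁ x) c₂ y) c₁ x' =
      Function.update (Function.update (Function.update B src s) c₁ x') c₂ y := by
  rw [Function.update_comm (Ne.symm h23), Function.update_idem]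

omit [DecidableEq Γ] in
/-- Reading the first of three stacked updates. [folklore] -/
theorem update3_apply_first (h12 : src ≠ c₁) (h13 : src ≠ c₂) (B : AStore Γ ι) (s x y : List Γ) :
    Function.update (Function.update (Function.update B src s) c₁ x) c₂ y src = s := by
  rw [Function.update_of_ne h13, Function.update_of_ne h12, Function.update_self]

omit [DecidableEq Γ] in
/-- Reading the second of three stacked updates. [folklore] -/
theorem update3_apply_second (h23 : c₁ ≠ c₂) (B : AStore Γ ι) (s x y : List Γ) :
    Function.update (Function.update (Function.update B src s) c₁ x) c₂ y c₁ = x := by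
  rw [Function.update_of_ne h23, Function.update_self]

end Upd3

/-! ### A loop over terminated entries with an action per entry -/

/-- Body of `forEach`: at the terminator run the action; otherwise collect the symbol in the
first or second collector if selected, else drop it. [folklore] -/
def forEachBody (c₁ c₂ : ι) (t : Γ) (d₁ d₂ : Γ → Bool) (A : ACom Γ ι) (a : Γ) : ACom Γ ι :=
  if a = t then A else if d₁ a = true then push c₁ a else if d₂ a = true then push c₂ a else skip

/-- `forEach src c₁ c₂ t d₁ d₂ A`: for each `t`-terminated entry of `src` (consumed), collect its
`d₁`-symbols in `c₁` and its `d₂`-symbols not selected by `d₁` (`sel₂`) in `c₂` (both reversed),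
drop the other symbols, and run the action `A` at the terminator. [folklore] -/
def forEach (src c₁ c₂ : ι) (t : Γ) (d₁ d₂ : Γ → Bool) (A : ACom Γ ι) : ACom Γ ι :=
  loop src (forEachBody c₁ c₂ t d₁ d₂ A)

/-- The second collection of an entry: the `d₂`-symbols among the non-`d₁`-symbols. [folklore] -/
def sel₂ (d₁ d₂ : Γ → Bool) (e : List Γ) : List Γ := e.filter fun a => !d₁ a && d₂ a

omit [DecidableEq Γ] [DecidableEq ι] in
/-- `sel₂` of a cons. [folklore] -/
theorem sel₂_cons (d₁ d₂ : Γ → Bool) (a : Γ) (e : List Γ) :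
    sel₂ d₁ d₂ (a :: e) = if !d₁ a && d₂ a then a :: sel₂ d₁ d₂ e else sel₂ d₁ d₂ e := by
  simp [sel₂, List.filter_cons]

section ForEach

variable {src c₁ c₂ : ι} (h12 : src ≠ c₁) (h13 : src ≠ c₂) (h23 : c₁ ≠ c₂)
  (t : Γ) (d₁ d₂ : Γ → Bool) (A : ACom Γ ι)

include h12 h13 h23

/-- **The symbols of one entry** before its terminator: collected or dropped. [folklore] -/
theorem segRuns_forEach_data (B : AStore Γ ι) :
    ∀ (u : List Γ), (∀ a ∈ u, a ≠ t) → ∀ (rest x y : List Γ),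
      SegRuns src (forEachBody c₁ c₂ t d₁ d₂ A) u
        (Function.update (Function.update (Function.update B src (u ++ rest)) c₁ x) c₂ y)
        (Function.update (Function.update (Function.update B src rest) c₁
          ((u.filter d₁).reverse ++ x)) c₂ ((sel₂ d₁ d₂ u).reverse ++ y))
        (3 * u.length)
  | [], _, rest, x, y => by simpa [sel₂] using SegRuns.nil src (forEachBody c₁ c₂ t d₁ d₂ A) _
  | a :: u, hu, rest, x, y => by
    have hat : a ≠ t := hu a (by simp)
    have hk : Function.update (Function.update (Function.update B src (a :: u ++ rest)) c₁ x) c₂ y src =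
        a :: (u ++ rest) := by
      rw [update3_apply_first h12 h13]; rfl
    by_cases hd1 : d₁ a = true
    · have ih := segRuns_forEach_data B u (fun b hb => hu b (by simp [hb])) rest (a :: x) y
      have hbody : Runs (forEachBody c₁ c₂ t d₁ d₂ A a)
          (Function.update (Function.update (Function.update (Function.update B src (a :: u ++ rest))
            c₁ x) c₂ y) src (u ++ rest))
          (Function.update (Function.update (Function.update B src (u ++ rest)) c₁ (a :: x)) c₂ y) 1 := by
        unfold forEachBody
        rw [if_neg hat, if_pos hd1, update3_first h12 h13]
        refine (Runs.push c₁ a _).of_eq ?_ le_rfl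
        rw [update3_apply_second h23, update3_second h23]
      refine (SegRuns.cons hk hbody ih).of_eq ?_ (by simp; omega)
      simp [sel₂_cons, hd1]
    · by_cases hd2 : d₂ a = true
      · have ih := segRuns_forEach_data B u (fun b hb => hu b (by simp [hb])) rest x (a :: y)
        have hbody : Runs (forEachBody c₁ c₂ t d₁ d₂ A a)
            (Function.update (Function.update (Function.update (Function.update B src (a :: u ++ rest))
              c₁ x) c₂ y) src (u ++ rest))
            (Function.update (Function.update (Function.update B src (u ++ rest)) c₁ x) c₂ (a :: y)) 1 := by
          unfold forEachBody
          rw [if_neg hat, if_neg hd1, if_pos hd2, update3_first h12 h13]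
          refine (Runs.push c₂ a _).of_eq ?_ le_rfl
          rw [Function.update_self, Function.update_idem]
        refine (SegRuns.cons hk hbody ih).of_eq ?_ (by simp; omega)
        simp [sel₂_cons, hd1, hd2]
      · have ih := segRuns_forEach_data B u (fun b hb => hu b (by simp [hb])) rest x y
        have hbody : Runs (forEachBody c₁ c₂ t d₁ d₂ A a)
            (Function.update (Function.update (Function.update (Function.update B src (a :: u ++ rest))
              c₁ x) c₂ y) src (u ++ rest))
            (Function.update (Function.update (Function.update B src (u ++ rest)) c₁ x) c₂ y) 0 := by
          unfold forEachBody
          rw [if_neg hat, if_neg hd1, if_neg hd2, update3_first h12 h13]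
          exact Runs.skip _
        refine (SegRuns.cons hk hbody ih).of_eq ?_ (by simp; omega)
        simp [sel₂_cons, hd1, hd2]

/-- **Segments of `forEach` by a fold invariant.** The entries are `f x` for `x` in a list `xs`
(of any type). If `S pre` describes the store after the entries of `pre` (outside `src`, `c₁`,
`c₂`), and for every decomposition `pre ++ x :: sfx` of `xs` the action leads from `S pre` —
with the rest of the word in `src` and the collections of `f x` in `c₁`, `c₂` — to
`S (pre ++ [x])` with the same `src` and empty collectors, within `C` steps, then the segment
over the suffix `sfx` leads from `S pre` to `S (pre ++ sfx)`. [folklore] -/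
theorem segRuns_forEach {α : Type} (f : α → List Γ) (S : List α → AStore Γ ι) (xs : List α)
    (hes : ∀ x ∈ xs, ∀ a ∈ f x, a ≠ t) (C : ℕ) (tail : List Γ)
    (hA : ∀ pre x sfx, pre ++ x :: sfx = xs →
      Runs A (Function.update (Function.update (Function.update (S pre) src
          (wEntries t (sfx.map f) ++ tail)) c₁ ((f x).filter d₁).reverse) c₂ (sel₂ d₁ d₂ (f x)).reverse)
        (Function.update (Function.update (Function.update (S (pre ++ [x])) src
          (wEntries t (sfx.map f) ++ tail)) c₁ []) c₂ []) C) :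
    ∀ (sfx pre : List α), pre ++ sfx = xs →
      SegRuns src (forEachBody c₁ c₂ t d₁ d₂ A) (wEntries t (sfx.map f))
        (Function.update (Function.update (Function.update (S pre) src (wEntries t (sfx.map f) ++ tail))
          c₁ []) c₂ [])
        (Function.update (Function.update (Function.update (S (pre ++ sfx)) src tail) c₁ []) c₂ [])
        ((C + 2) * sfx.length + 3 * (wEntries t (sfx.map f)).length)
  | [], pre, _ => by
    simpa [wEntries] using SegRuns.nil src (forEachBody c₁ c₂ t d₁ d₂ A) _
  | x :: sfx, pre, hpe => by
    have he : ∀ a ∈ f x, a ≠ t := hes x (by rw [← hpe]; simp)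
    have h1 := segRuns_forEach_data h12 h13 h23 t d₁ d₂ A (S pre) (f x) he
      (t :: (wEntries t (sfx.map f) ++ tail)) [] []
    simp only [List.append_nil] at h1
    set R1 := Function.update (Function.update (Function.update (S pre) src
      (t :: (wEntries t (sfx.map f) ++ tail))) c₁ ((f x).filter d₁).reverse) c₂ (sel₂ d₁ d₂ (f x)).reverse
      with hR1
    have hk : R1 src = t :: (wEntries t (sfx.map f) ++ tail) := by
      rw [hR1, update3_apply_first h12 h13]
    have hbody : Runs (forEachBody c₁ c₂ t d₁ d₂ A t) (Function.update R1 src (wEntries t (sfx.map f) ++ tail))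
        (Function.update (Function.update (Function.update (S (pre ++ [x])) src
          (wEntries t (sfx.map f) ++ tail)) c₁ []) c₂ []) C := by
      unfold forEachBody
      rw [if_pos rfl, hR1, update3_first h12 h13]
      exact hA pre x sfx hpe
    have ih := segRuns_forEach f S xs hes C tail hA sfx (pre ++ [x]) (by simpa using hpe)
    have h2 := SegRuns.cons hk hbody ih
    have h12' := h1.append h2
    rw [List.map_cons, wEntries_cons]
    rw [show f x ++ t :: wEntries t (sfx.map f) ++ tail = f x ++ t :: (wEntries t (sfx.map f) ++ tail) by simp]
    refine h12'.of_eq (by simp) ?_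
    simp only [List.length_cons, List.length_append]
    ring_nf
    omega

/-- **Specification of `forEach`** (cf. `segRuns_forEach`): from `src = wEntries t (xs.map f)` and
empty collectors over `S []`, the loop ends over `S xs` with `src` and the collectors empty.
[folklore] -/
theorem runs_forEach {α : Type} (f : α → List Γ) (S : List α → AStore Γ ι) (xs : List α)
    (hes : ∀ x ∈ xs, ∀ a ∈ f x, a ≠ t) (C : ℕ)
    (hA : ∀ pre x sfx, pre ++ x :: sfx = xs →
      Runs A (Function.update (Function.update (Function.update (S pre) src (wEntries t (sfx.map f)))
          c₁ ((f x).filter d₁).reverse) c₂ (sel₂ d₁ d₂ (f x)).reverse)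
        (Function.update (Function.update (Function.update (S (pre ++ [x])) src (wEntries t (sfx.map f)))
          c₁ []) c₂ []) C) :
    Runs (forEach src c₁ c₂ t d₁ d₂ A)
      (Function.update (Function.update (Function.update (S []) src (wEntries t (xs.map f))) c₁ []) c₂ [])
      (Function.update (Function.update (Function.update (S xs) src []) c₁ []) c₂ [])
      ((C + 2) * xs.length + 3 * (wEntries t (xs.map f)).length + 1) := by
  have h := segRuns_forEach h12 h13 h23 t d₁ d₂ A f S xs hes C []
    (fun pre x sfx hh => by simpa using hA pre x sfx hh) xs [] rfl
  simp only [List.append_nil, List.nil_append] at h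
  unfold forEach
  exact h.runs_loop_nil (by rw [update3_apply_first h12 h13])

end ForEach

/-! ### While loops driven by a one-symbol register -/

/-- `whileLoop go body`: pop the register `go` and run `body`, repeatedly; the body re-arms `go`
(pushes one symbol) to request another iteration. [folklore] -/
def whileLoop (go : ι) (body : ACom Γ ι) : ACom Γ ι := loop go fun _ => body

omit [DecidableEq Γ] in
/-- **Specification of `whileLoop`** by an indexed family of stores: if `S i` (`go` empty)
describes the store before iteration `i`, and iteration `i < N` leads to `S (i + 1)` with `go`
re-armed iff `i + 1 < N`, then from `S i₀` armed the loop ends in `S N` after `N - i₀`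
iterations. [folklore] -/
theorem runs_whileLoop_from (go : ι) (g : Γ) (body : ACom Γ ι) (S : ℕ → AStore Γ ι) (N C : ℕ)
    (hgo : ∀ i, S i go = [])
    (hstep : ∀ i, i < N → Runs body (S i)
      (Function.update (S (i + 1)) go (if i + 1 < N then [g] else [])) C) :
    ∀ (d i : ℕ), i + d + 1 = N →
      Runs (whileLoop go body) (Function.update (S i) go [g]) (S N) ((C + 2) * (d + 1) + 1)
  | 0, i, hi => by
    have hiN : i < N := by omega
    have hs := hstep i hiN
    rw [if_neg (by omega)] at hs
    have e1 : Function.update (S (i + 1)) go [] = S N := by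
      rw [show i + 1 = N by omega]; exact (Function.update_eq_self_iff.2 (hgo N).symm)
    rw [e1] at hs
    have hk : Function.update (S i) go [g] go = [g] := Function.update_self ..
    have hs' : Runs body (Function.update (Function.update (S i) go [g]) go []) (S N) C := by
      rwa [Function.update_idem, Function.update_eq_self_iff.2 (hgo i).symm]
    unfold whileLoop
    have := Runs.loop_cons (f := fun _ => body) hk hs' (Runs.loop_nil (fun _ => body) (hgo N))
    exact this.mono (by omega)
  | d + 1, i, hi => by
    have hiN : i + 1 < N := by omega
    have hs := hstep i (by omega)
    rw [if_pos hiN] at hs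
    have hk : Function.update (S i) go [g] go = [g] := Function.update_self ..
    have hs' : Runs body (Function.update (Function.update (S i) go [g]) go [])
        (Function.update (S (i + 1)) go [g]) C := by
      rwa [Function.update_idem, Function.update_eq_self_iff.2 (hgo i).symm]
    have ih := runs_whileLoop_from go g body S N C hgo hstep d (i + 1) (by omega)
    unfold whileLoop at ih ⊢
    have := Runs.loop_cons (f := fun _ => body) hk hs' ih
    refine this.mono ?_
    ring_nf; omega

omit [DecidableEq Γ] in
/-- **Specification of `whileLoop`** from the first iteration: `N ≥ 1` iterations. [folklore] -/
theorem runs_whileLoop (go : ι) (g : Γ) (body : ACom Γ ι) (S : ℕ → AStore Γ ι) (N C : ℕ)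
    (hN : 0 < N) (hgo : ∀ i, S i go = [])
    (hstep : ∀ i, i < N → Runs body (S i)
      (Function.update (S (i + 1)) go (if i + 1 < N then [g] else [])) C) :
    Runs (whileLoop go body) (Function.update (S 0) go [g]) (S N) ((C + 2) * N + 1) := by
  have := runs_whileLoop_from go g body S N C hgo hstep (N - 1) 0 (by omega)
  rwa [show N - 1 + 1 = N by omega] at this

/-! ### Tallies: counting the symbols of a register by classes -/

/-- `tally src tk f`: consume `src`; for every symbol `a` with `f a = some r` push one tick `tk`
onto `r`. [folklore] -/
def tally (src : ι) (tk : Γ) (f : Γ → Option ι) : ACom Γ ι :=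
  loop src fun a => match f a with
    | some r => push r tk
    | none => skip

/-- The number of symbols of `w` in the class of register `r`. [folklore] -/
def tallyCount (f : Γ → Option ι) (r : ι) (w : List Γ) : ℕ := (w.filter fun a => f a = some r).length

omit [DecidableEq Γ] in
/-- `tallyCount` of a cons. [folklore] -/
theorem tallyCount_cons (f : Γ → Option ι) (r : ι) (a : Γ) (w : List Γ) :
    tallyCount f r (a :: w) = (if f a = some r then 1 else 0) + tallyCount f r w := by
  unfold tallyCount
  rw [List.filter_cons]
  by_cases h : f a = some r <;> simp [h, Nat.add_comm]

/-- The store during a tally: `src` holds `rest`, every other register has received the ticks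
of the consumed symbols `done`. [folklore] -/
def tallySt (src : ι) (tk : Γ) (f : Γ → Option ι) (R : AStore Γ ι) (done rest : List Γ) : AStore Γ ι :=
  fun r => if r = src then rest else List.replicate (tallyCount f r done) tk ++ R r

omit [DecidableEq Γ] in
/-- **Specification of `tally`**: with no class mapped to `src`, the tally empties `src` and
prepends `tk^{count}` to every register, `count` the number of consumed symbols of its class.
[folklore] -/
theorem runs_tally (src : ι) (tk : Γ) (f : Γ → Option ι) (hf : ∀ a, f a ≠ some src)
    (R : AStore Γ ι) (w : List Γ) :
    Runs (tally src tk f) (Function.update R src w) (tallySt src tk f R w []) (3 * w.length + 1) := by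
  have h := runs_loop_inv (k := src) (f := fun a => match f a with
      | some r => push r tk
      | none => skip)
    (fun done rest => tallySt src tk f R done rest) (fun _ _ => True) 1
    (fun done rest _ => by simp [tallySt])
    (fun done a rest _ => ⟨trivial, by
      cases hfa : f a with
      | none =>
        refine (Runs.skip _).of_eq ?_ (by omega)
        funext r
        by_cases hr : r = src
        · subst hr; simp [tallySt]
        · simp [tallySt, hr, tallyCount_cons, hfa]
      | some q =>
        have hq : q ≠ src := fun e => hf a (by rw [hfa, e])
        refine (Runs.push q tk _).of_eq ?_ le_rfl
        funext r
        by_cases hr : r = src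
        · subst hr
          simp [tallySt, Function.update_of_ne (Ne.symm hq)]
        · by_cases hrq : r = q
          · subst hrq
            rw [Function.update_self, Function.update_of_ne hr]
            simp only [tallySt, if_neg hr, tallyCount_cons, hfa, if_true]
            rw [Nat.add_comm, List.replicate_succ, List.cons_append]
          · rw [Function.update_of_ne hrq, Function.update_of_ne hr]
            have : ¬ f a = some r := by rw [hfa]; simpa using Ne.symm hrq
            simp [tallySt, hr, tallyCount_cons, this]⟩)
    w [] trivial
  have e0 : tallySt src tk f R [] w = Function.update R src w := by
    funext r
    by_cases hr : r = src
    · subst hr; simp [tallySt]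
    · simp [tallySt, hr, tallyCount]
  rw [e0] at h
  simp only [List.append_nil] at h
  unfold tally
  refine h.of_eq ?_ (by omega)
  funext r
  by_cases hr : r = src
  · subst hr; simp [tallySt]
  · simp only [tallySt, if_neg hr]
    unfold tallyCount
    rw [List.filter_reverse, List.length_reverse]

/-! ### Comparing two unary registers -/

/-- `cmpU a b gt lt tk`: pop `a` and `b` in lockstep (consuming both); raise `gt` if `a` outlasts
`b`, then raise `lt` if `b` has symbols left (and clear them). [folklore] -/
def cmpU (a b gt lt : ι) (tk : Γ) : ACom Γ ι :=
  loop a (fun _ => pop b fun o => match o with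
    | some _ => skip
    | none => setFlagG tk gt) ;;
  pop b fun o => match o with
    | some _ => setFlagG tk lt ;; clear b
    | none => skip

/-- The store during the lockstep loop of `cmpU`. [folklore] -/
def cmpSt (a b gt : ι) (tk : Γ) (R : AStore Γ ι) (i j : ℕ) (p : Prop) [Decidable p] : AStore Γ ι :=
  Function.update (Function.update (Function.update R a (List.replicate i tk)) b (List.replicate j tk))
    gt (flagW tk p)

omit [DecidableEq Γ] in
/-- The lockstep loop of `cmpU`. [folklore] -/
theorem runs_cmpU_loop {a b gt : ι} (hab : a ≠ b) (hag : a ≠ gt) (hbg : b ≠ gt) (tk : Γ)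
    (R : AStore Γ ι) :
    ∀ (i j : ℕ) (p : Prop) [Decidable p],
      Runs (loop a (fun _ => pop b fun o => match o with
        | some _ => skip
        | none => setFlagG tk gt))
        (cmpSt a b gt tk R i j p) (cmpSt a b gt tk R 0 (j - i) (p ∨ j < i)) (9 * i + 1)
  | 0, j, p, _ => by
    have := Runs.loop_nil (fun _ => pop b fun o => match o with
        | some _ => skip
        | none => setFlagG tk gt) (k := a) (R := cmpSt a b gt tk R 0 j p)
      (by simp [cmpSt, Function.update_of_ne hag, Function.update_of_ne hab])
    refine this.of_eq ?_ (by omega)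
    unfold cmpSt
    rw [Nat.sub_zero, flagW_congr tk (show (p ∨ j < 0) ↔ p by simp)]
  | i + 1, j, p, _ => by
    have hk : cmpSt a b gt tk R (i + 1) j p a = tk :: List.replicate i tk := by
      simp [cmpSt, Function.update_of_ne hag, Function.update_of_ne hab, List.replicate_succ]
    have e0 : Function.update (cmpSt a b gt tk R (i + 1) j p) a (List.replicate i tk) =
        cmpSt a b gt tk R i j p := by
      unfold cmpSt
      rw [Function.update_comm (Ne.symm hag), Function.update_comm (Ne.symm hab), Function.update_idem,
        Function.update_comm hab, Function.update_comm hag]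
    cases j with
    | zero =>
      have hb : cmpSt a b gt tk R i 0 p b = [] := by
        simp [cmpSt, Function.update_of_ne hbg]
      have hlen : (cmpSt a b gt tk R i 0 p gt).length ≤ 1 := by
        simp [cmpSt, length_flagW_le]
      have hset := runs_setFlagG tk gt (cmpSt a b gt tk R i 0 p) hlen
      have e1 : Function.update (cmpSt a b gt tk R i 0 p) gt [tk] = cmpSt a b gt tk R i 0 (p ∨ 0 < i + 1) := by
        have hf : flagW tk (p ∨ 0 < i + 1) = [tk] := by simp [flagW]
        unfold cmpSt
        rw [Function.update_idem, hf]
      rw [e1] at hset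
      have hbody := Runs.pop_nil (k := b) (f := fun o => match o with
        | some _ => skip
        | none => setFlagG tk gt) hb hset
      have ih := runs_cmpU_loop hab hag hbg tk R i 0 (p ∨ 0 < i + 1)
      have := Runs.loop_cons' hk e0 hbody ih
      refine this.of_eq ?_ (by omega)
      unfold cmpSt
      rw [Nat.zero_sub, Nat.zero_sub, flagW_congr tk (show ((p ∨ 0 < i + 1) ∨ 0 < i) ↔ (p ∨ 0 < i + 1) by simp)]
    | succ j =>
      have hb : cmpSt a b gt tk R i (j + 1) p b = tk :: List.replicate j tk := by
        simp [cmpSt, Function.update_of_ne hbg, List.replicate_succ]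
      have e1 : Function.update (cmpSt a b gt tk R i (j + 1) p) b (List.replicate j tk) =
          cmpSt a b gt tk R i j p := by
        unfold cmpSt
        rw [Function.update_comm (Ne.symm hbg), Function.update_idem, Function.update_comm hbg]
      have hbody := Runs.pop_cons' (k := b) (f := fun o => match o with
        | some _ => skip
        | none => setFlagG tk gt) hb e1 (Runs.skip _)
      have ih := runs_cmpU_loop hab hag hbg tk R i j p
      have := Runs.loop_cons' hk e0 hbody ih
      refine this.of_eq ?_ (by omega)
      rw [Nat.succ_sub_succ]
      unfold cmpSt
      rw [flagW_congr tk (show (p ∨ j < i) ↔ (p ∨ j + 1 < i + 1) by simp)]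

omit [DecidableEq Γ] in
/-- **Specification of `cmpU`**: from `a = tk^i`, `b = tk^j` and normalised flags `gt = flagW p`,
`lt = flagW q`, both registers are emptied and the flags become `flagW (p ∨ j < i)`,
`flagW (q ∨ i < j)`. [folklore] -/
theorem runs_cmpU {a b gt lt : ι} (hab : a ≠ b) (hag : a ≠ gt) (hbg : b ≠ gt) (hal : a ≠ lt)
    (hbl : b ≠ lt) (hgl : gt ≠ lt) (tk : Γ) (R : AStore Γ ι) (i j : ℕ) (p q : Prop) [Decidable p]
    [Decidable q] (hlt : R lt = flagW tk q) :
    Runs (cmpU a b gt lt tk) (cmpSt a b gt tk R i j p)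
      (Function.update (cmpSt a b gt tk R 0 0 (p ∨ j < i)) lt (flagW tk (q ∨ i < j)))
      (9 * i + 2 * j + 9) := by
  unfold cmpU
  have h1 := runs_cmpU_loop hab hag hbg tk R i j p
  set R1 := cmpSt a b gt tk R 0 (j - i) (p ∨ j < i) with hR1
  have hlt1 : R1 lt = flagW tk q := by
    simp [hR1, cmpSt, Function.update_of_ne (Ne.symm hgl), Function.update_of_ne (Ne.symm hbl),
      Function.update_of_ne (Ne.symm hal), hlt]
  by_cases hij : i < j
  · obtain ⟨d, hd⟩ : ∃ d, j - i = d + 1 := ⟨j - i - 1, by omega⟩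
    have hb : R1 b = tk :: List.replicate d tk := by
      simp [hR1, cmpSt, Function.update_of_ne hbg, hd, List.replicate_succ]
    have hlen : (Function.update R1 b (List.replicate d tk) lt).length ≤ 1 := by
      rw [Function.update_of_ne (Ne.symm hbl), hlt1]; exact length_flagW_le _ _
    have hset := runs_setFlagG tk lt (Function.update R1 b (List.replicate d tk)) hlen
    have hclr := runs_clear b (Function.update (Function.update R1 b (List.replicate d tk)) lt [tk])
    have eb : Function.update (Function.update R1 b (List.replicate d tk)) lt [tk] b = List.replicate d tk := by
      rw [Function.update_of_ne hbl, Function.update_self]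
    rw [eb, List.length_replicate] at hclr
    have h2 := Runs.pop_cons (k := b) (f := fun o => match o with
      | some _ => setFlagG tk lt ;; clear b
      | none => skip) hb (hset.seq hclr)
    refine (h1.seq h2).of_eq ?_ (by omega)
    have hf : flagW tk (q ∨ i < j) = [tk] := by simp [flagW, hij]
    rw [hf, hR1]
    unfold cmpSt
    funext r
    by_cases hrb : r = b
    · subst hrb
      simp [Function.update_of_ne hbl, Function.update_of_ne hbg]
    · rw [Function.update_of_ne hrb]
      by_cases hrl : r = lt
      · subst hrl; simp
      · by_cases hrg : r = gt
        · subst hrg; simp [hrb, hrl]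
        · simp [hrb, hrl, hrg]
  · have hb : R1 b = [] := by
      simp [hR1, cmpSt, Function.update_of_ne hbg, show j - i = 0 by omega]
    have h2 := Runs.pop_nil (k := b) (f := fun o => match o with
      | some _ => setFlagG tk lt ;; clear b
      | none => skip) hb (Runs.skip R1)
    refine (h1.seq h2).of_eq ?_ (by omega)
    rw [hR1, show j - i = 0 by omega]
    have e : cmpSt a b gt tk R 0 0 (p ∨ j < i) lt = flagW tk q := by
      simp [cmpSt, Function.update_of_ne (Ne.symm hgl), Function.update_of_ne (Ne.symm hbl),
        Function.update_of_ne (Ne.symm hal), hlt]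
    symm
    apply Function.update_eq_self_iff.2
    rw [e]
    exact flagW_congr tk (by simp [hij])

/-! ### Non-destructive copy on any register file -/

/-- `copyToG a b t₁ t₂`: copy register `a` onto the empty register `b`, keeping `a`, through two
empty scratch registers. [folklore] -/
def copyToG (a b t₁ t₂ : ι) : ACom Γ ι := copy2 a t₁ t₂ ;; pour t₁ a ;; pour t₂ b

omit [DecidableEq Γ] in
/-- **Specification of `copyToG`.** [folklore] -/
theorem runs_copyToG {a b t₁ t₂ : ι} (hab : a ≠ b) (ha1 : a ≠ t₁) (ha2 : a ≠ t₂) (hb1 : b ≠ t₁)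
    (hb2 : b ≠ t₂) (h12 : t₁ ≠ t₂) (R : AStore Γ ι) (h1 : R t₁ = []) (h2 : R t₂ = []) (hb : R b = []) :
    Runs (copyToG a b t₁ t₂) R (Function.update R b (R a)) (10 * (R a).length + 3) := by
  unfold copyToG
  have c := runs_copy2 ha1 ha2 h12 R
  rw [h1, h2] at c
  simp only [List.append_nil] at c
  set R1 := Function.update (Function.update (Function.update R a []) t₁ (R a).reverse) t₂ (R a).reverse
    with hR1
  have p1 := runs_pour (a := t₁) (b := a) (Ne.symm ha1) R1
  have e1 : R1 t₁ = (R a).reverse := by simp [hR1, Function.update_of_ne h12]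
  have e1' : R1 a = [] := by simp [hR1, Function.update_of_ne ha2, Function.update_of_ne ha1]
  rw [e1, e1', List.length_reverse, List.reverse_reverse, List.append_nil] at p1
  set R2 := Function.update (Function.update R1 t₁ []) a (R a) with hR2
  have p2 := runs_pour (a := t₂) (b := b) (Ne.symm hb2) R2
  have e2 : R2 t₂ = (R a).reverse := by
    simp [hR2, hR1, Function.update_of_ne (Ne.symm ha2), Function.update_of_ne (Ne.symm h12)]
  have e2' : R2 b = [] := by
    simp [hR2, hR1, Function.update_of_ne (Ne.symm hab), Function.update_of_ne hb1, Function.update_of_ne hb2, hb]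
  rw [e2, e2', List.length_reverse, List.reverse_reverse, List.append_nil] at p2
  refine (c.seq (p1.seq p2)).of_eq ?_ (by omega)
  rw [hR2, hR1]
  funext r
  by_cases hra : r = a
  · subst hra
    simp [Function.update_of_ne hab, Function.update_of_ne ha2]
  · by_cases hrb : r = b
    · subst hrb; simp
    · by_cases hr1 : r = t₁
      · subst hr1
        simp [Function.update_of_ne (Ne.symm hb1), Function.update_of_ne h12, Function.update_of_ne (Ne.symm ha1), h1]
      · by_cases hr2 : r = t₂
        · subst hr2
          simp [Function.update_of_ne (Ne.symm hb2), h2]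
        · simp [Function.update_of_ne hrb, Function.update_of_ne hr2, Function.update_of_ne hra,
            Function.update_of_ne hr1]

end Literature.Computability.FineGrained.IPRenameM
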